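import Mathlib
import HarnessLib

/-!
# The period function of the hardening Duffing oscillator is strictly decreasing (Chow–Wang 1986)

Topic `Literature/Analysis/ODE`. Named fact (D-0014) + derived theorem for the one printed input of route
`Summit.AtomisticToContinuum.FouriersLaw.Theses.KacRangeDichotomy` that is a theorem in print: the
monotonicity ("twist") of the period function of `x'' + A x + B x³ = 0`, `A, B > 0` — support item
`DuffingTwist` of that route, verbatim.

Source: S.-N. Chow, D. Wang, *On the monotonicity of the period function of some second order
equations*, Časopis pěst. mat. 111 (1986) 14–25 (read this session, Czech DML open access). For
`x'' + g(x) = 0`, `G(x) = ∫₀ˣ g`, the periodic orbit of energy `c` through `(a,0)`, `(b,0)`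
(`G(a) = G(b) = c`) has least period `p(c) = √2 ∫ₐᵇ dx/√(c − G(x))` ((1.3), p. 15). Hypothesis (H1)
(p. 16): `g(x) = x^{2N+1} h(x)` with `h > 0` smooth on `(a*, b*)`, `G(a*) = G(b*) = c*`. **Corollary
2.3** (p. 18): "If (H1) holds and `x g''(x) < 0` (or `> 0`), `x ≠ 0`, `a* < x < b*`, then `p'(c) > 0`
(or `< 0`), `0 < c < c*`." **Example 3, (3.c) with `b = 0`** (p. 23): "`g(x) = x³ + x`, `g''(x) = 6x`.
Then by Corollary 2.3, `p'(c) < 0`, `0 < c < +∞`"; likewise (3.d) `g(x) = x³`. For `g(x) = Ax + Bx³`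
with `A, B > 0`: `g = x·(A + Bx²)`, (H1) holds with `N = 0`, `h = A + Bx² > 0`, `a* = −∞`, `b* = +∞`,
`c* = +∞`, and `x g''(x) = 6Bx² > 0` for `x ≠ 0`, so Corollary 2.3 gives `p'(c) < 0` on `(0, ∞)`
(equivalently: rescale `x = √(A/B) y`, `t = s/√A` to (3.c)). See also C. Chicone, J. Differential
Equations 69 (1987) 310–321 (monotonicity criteria for planar Hamiltonian period functions).

What is recorded: the HALF period `E ↦ ∫_{V(q) < E} (2(E − V(q)))^{-1/2} dq = p(E)/2`,
`V(q) = Aq²/2 + Bq⁴/4`, is strictly decreasing on `(0, ∞)` — exactly the shape of the route item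
(a Lebesgue integral over the open sublevel set; the integrand is integrable there, with inverse
square-root singularities at the turning points).
-/

noncomputable section

namespace Literature.Analysis.ODE

/-- **Chow–Wang 1986, Corollary 2.3 (general criterion), in the global case `a* = −∞`,
`b* = +∞`.** Printed: hypothesis (H1) (p. 16): "`g(x) = x^{2N+1} h(x)`, `a* < x < b*`", `h` a
positive smooth function, `N ≥ 0` an integer, "`0 < G(a*) = G(b*) = c* ≤ +∞`" (`G = ∫₀ g`; here
`a* = −∞`, `b* = +∞`, `c* = +∞`, i.e. `G → +∞` at `±∞`, so that every energy level `c > 0` is a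
periodic orbit around the unique critical point `0`); Corollary 2.3 (p. 18): "If (H1) holds and
`x g''(x) < 0` (or `> 0`), `x ≠ 0`, `a* < x < b*`, then `p'(c) > 0` (or `< 0`), `0 < c < c*`",
`p(c) = √2 ∫ₐᵇ dx/√(c − G(x))` ((1.3)). Recorded (the `> 0` case) with the SMOOTH data of the
source ("`g(x)` is smooth for all `x ∈ ℝ`", p. 15; "a positive smooth function `h(x)`", p. 16 —
`ContDiff ℝ ⊤`), in the half-period / sublevel-set form, as strict antitonicity on `(0, ∞)`.
[cite: ChowWang1986, Cor. 2.3 (with hypothesis (H1), §2)] -/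
def chowWang1986_cor_2_3_global : Prop :=
  ∀ g : ℝ → ℝ, ContDiff ℝ (⊤ : ℕ∞) g →
    (∃ (N : ℕ) (h : ℝ → ℝ), ContDiff ℝ (⊤ : ℕ∞) h ∧ (∀ x, 0 < h x) ∧
      ∀ x, g x = x ^ (2 * N + 1) * h x) →
    (∀ x, x ≠ 0 → 0 < x * deriv (deriv g) x) →
    Filter.Tendsto (fun x => ∫ y in (0 : ℝ)..x, g y) Filter.atTop Filter.atTop →
    Filter.Tendsto (fun x => ∫ y in (0 : ℝ)..x, g y) Filter.atBot Filter.atTop →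
    StrictAntiOn (fun E : ℝ => ∫ q in {q : ℝ | (∫ y in (0 : ℝ)..q, g y) < E},
      (Real.sqrt (2 * (E - ∫ y in (0 : ℝ)..q, g y)))⁻¹) (Set.Ioi 0)


/-- **The hardening Duffing equation `x'' + Ax + Bx³ = 0`, `A, B > 0`: the period function is
strictly decreasing in the energy** — Chow–Wang 1986, Example 3 (3.c) (`g = x³ + x`, `b = 0`:
"by Corollary 2.3, `p'(c) < 0`, `0 < c < +∞`"), here for all `A, B > 0` DERIVED from the general
criterion `chowWang1986_cor_2_3_global` with `g = Ax + Bx³ = x·(A + Bx²)` (`N = 0`,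
`h = A + Bx² > 0`, `x g''(x) = 6Bx² > 0`, `G(x) = Ax²/2 + Bx⁴/4 → +∞` at `±∞`). The conclusion is the
support item `DuffingTwist` of route FouriersLaw/KacRangeDichotomy verbatim: the half-period
`E ↦ ∫_{Aq²/2 + Bq⁴/4 < E} (2(E − Aq²/2 − Bq⁴/4))^{-1/2} dq` is strictly antitone on `(0, ∞)`.
[cite: ChowWang1986, Cor. 2.3 and Example 3 (3.c)] -/
theorem duffing_period_strictAntiOn_of_chowWang (hcw : chowWang1986_cor_2_3_global) :
    ∀ A B : ℝ, 0 < A → 0 < B →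
      StrictAntiOn (fun E : ℝ => ∫ q in {q : ℝ | A * q ^ 2 / 2 + B * q ^ 4 / 4 < E},
        (Real.sqrt (2 * (E - (A * q ^ 2 / 2 + B * q ^ 4 / 4))))⁻¹) (Set.Ioi 0) := by
  intro A B hA hB
  set g : ℝ → ℝ := fun x => A * x + B * x ^ 3 with hg
  -- smoothness and the factorisation `g = x · (A + B x²)`
  have hg_smooth : ContDiff ℝ (⊤ : ℕ∞) g := by
    rw [hg]; fun_prop
  have hfact : ∃ (N : ℕ) (h : ℝ → ℝ), ContDiff ℝ (⊤ : ℕ∞) h ∧ (∀ x, 0 < h x) ∧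
      ∀ x, g x = x ^ (2 * N + 1) * h x := by
    refine ⟨0, fun x => A + B * x ^ 2, by fun_prop, fun x => by positivity, fun x => ?_⟩
    simp only [hg]; ring
  -- `x g''(x) = 6 B x² > 0`
  have hd1 : deriv g = fun x => A + 3 * B * x ^ 2 := by
    funext x
    have h1 : HasDerivAt g (A * 1 + B * (↑3 * x ^ (3 - 1) * 1)) x := by
      rw [hg]
      exact ((hasDerivAt_id x).const_mul A).add (((hasDerivAt_id x).pow 3).const_mul B)
    rw [h1.deriv]; push_cast; ring
  have hd2 : deriv (deriv g) = fun x => 6 * B * x := by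
    rw [hd1]; funext x
    have h2 : HasDerivAt (fun x => A + 3 * B * x ^ 2) (0 + 3 * B * (↑2 * x ^ (2 - 1) * 1)) x :=
      (hasDerivAt_const x A).add (((hasDerivAt_id x).pow 2).const_mul (3 * B))
    rw [h2.deriv]; push_cast; ring
  have hconv : ∀ x, x ≠ 0 → 0 < x * deriv (deriv g) x := by
    intro x hx
    rw [hd2]
    have hxx : 0 < x * x := mul_self_pos.2 hx
    nlinarith
  -- the primitive `G(x) = A x²/2 + B x⁴/4` and its behaviour at `±∞`
  have hG : ∀ x, ∫ y in (0 : ℝ)..x, g y = A * x ^ 2 / 2 + B * x ^ 4 / 4 := by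
    intro x
    have h1 : IntervalIntegrable (fun y => A * y) MeasureTheory.volume 0 x :=
      (Continuous.intervalIntegrable (by fun_prop) 0 x)
    have h2 : IntervalIntegrable (fun y => B * y ^ 3) MeasureTheory.volume 0 x :=
      (Continuous.intervalIntegrable (by fun_prop) 0 x)
    simp only [hg]
    rw [intervalIntegral.integral_add h1 h2, intervalIntegral.integral_const_mul,
      intervalIntegral.integral_const_mul, integral_id, integral_pow]
    ring
  have hpoly : (fun x => ∫ y in (0 : ℝ)..x, g y) = fun x => A / 2 * x ^ 2 + B / 4 * x ^ 4 := by
    funext x; rw [hG]; ring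
  have hsq_top : Filter.Tendsto (fun x : ℝ => x ^ 2) Filter.atTop Filter.atTop :=
    Filter.tendsto_pow_atTop two_ne_zero
  have hsq_bot : Filter.Tendsto (fun x : ℝ => x ^ 2) Filter.atBot Filter.atTop := by
    have := (Filter.tendsto_pow_atTop (α := ℝ) two_ne_zero).comp Filter.tendsto_neg_atBot_atTop
    simpa [Function.comp_def] using this
  have h4_top : Filter.Tendsto (fun x : ℝ => x ^ 4) Filter.atTop Filter.atTop :=
    Filter.tendsto_pow_atTop (by norm_num)
  have h4_bot : Filter.Tendsto (fun x : ℝ => x ^ 4) Filter.atBot Filter.atTop := by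
    have := (Filter.tendsto_pow_atTop (α := ℝ) (n := 4) (by norm_num)).comp
      Filter.tendsto_neg_atBot_atTop
    simpa [Function.comp_def, show ∀ x : ℝ, (-x) ^ 4 = x ^ 4 from fun x => by ring] using this
  have htop : Filter.Tendsto (fun x => ∫ y in (0 : ℝ)..x, g y) Filter.atTop Filter.atTop := by
    rw [hpoly]
    exact (hsq_top.const_mul_atTop (by positivity)).atTop_add_atTop
      (h4_top.const_mul_atTop (by positivity))
  have hbot : Filter.Tendsto (fun x => ∫ y in (0 : ℝ)..x, g y) Filter.atBot Filter.atTop := by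
    rw [hpoly]
    exact (hsq_bot.const_mul_atTop (by positivity)).atTop_add_atTop
      (h4_bot.const_mul_atTop (by positivity))
  have key := hcw g hg_smooth hfact hconv htop hbot
  simp only [hG] at key
  exact key

end Literature.Analysis.ODE
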